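import Mathlib
import Summits.Ventures.PercRepro2.ZMeanProof
import Summits.Ventures.PercRepro2.PendantRoot
import Summits.Ventures.PercRepro2.GcTransport

/-!
# Pinned closed = re-routed to a loop, for the mean field (blind cell PercRepro2, night-1 g7)

The analogue of `RECM.Gc_update_zero_eq_loop` (GcTransport.lean, p1 g11) for the mean-field
functional: `HMFc (p[e ↦ 0]) ends = HMFc p ends'` where `ends'` re-routes `e` to the loop
`s(v, v)` (`HMFc_update_zero_eq_loop`).  The masses transport along `Ψ ω = ω[e ↦ false]`
(`prob_update_zero_eq_preimage`, `conn_update_false_iff_loop`); for `X̂` the cluster events and the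
residual connection events transport too, because `restrict` commutes with forcing `e` closed and a
loop edge never contributes to connectivity (`conn_update_of_isDiag`).  Use: it turns a structural
hypothesis «no other edge at the mark» into a weight hypothesis — the extra edge is re-routed away.
-/

namespace Summit.Ventures.PercRepro2

open UnionCluster CovForm PendantRoot RECM

namespace HMFLoop

open scoped Classical

variable {V : Type*} {E : Type*} [Fintype E] [DecidableEq E] [Fintype V] [DecidableEq V]
  {R : Type*} [Field R] [LinearOrder R] [IsStrictOrderedRing R]

variable (p : E → R) (ends : E → Sym2 V) (e : E) (v : V)

omit [Fintype E] [Fintype V] [DecidableEq V] in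
/-- `restrict` commutes with forcing an edge closed (the decidability instance is unified, not
synthesised). -/
lemma restrict_update_false (S : Set E) {inst : DecidablePred (· ∈ S)} (ω : Config E) :
    @restrict E S inst (Function.update ω e false) = Function.update (@restrict E S inst ω) e false := by
  funext g
  by_cases hg : g = e
  · subst hg; simp [restrict]
  · simp [restrict, Function.update_of_ne hg]

omit [Fintype E] [Fintype V] [DecidableEq V] in
/-- Off `e`, the edges touching `W` are the same in `ends` and in the loop graph. -/
lemma mem_touches_loop_iff {W : Set V} {g : E} (hg : g ≠ e) :
    g ∈ touches (Function.update ends e s(v, v)) W ↔ g ∈ touches ends W := by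
  simp only [touches, Set.mem_setOf_eq, Function.update_of_ne hg]

omit [Fintype E] [Fintype V] [DecidableEq V] in
/-- The cluster event transports to the loop graph. -/
lemma preimage_clusterEvent (a₃ : V) (W : Set V) :
    (fun ω => Function.update ω e false) ⁻¹' clusterEvent ends a₃ W =
      clusterEvent (Function.update ends e s(v, v)) a₃ W := by
  ext ω
  simp only [Set.mem_preimage, mem_clusterEvent]
  have : cluster ends (Function.update ω e false) a₃ = cluster (Function.update ends e s(v, v)) ω a₃ := by
    ext z
    simp only [mem_cluster]
    exact conn_update_false_iff_loop ends e v ω a₃ z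
  rw [this]

omit [Fintype E] in
/-- The residual connection event transports to the loop graph. -/
lemma preimage_connDelEvent (W : Finset V) (u w : V) :
    (fun ω => Function.update ω e false) ⁻¹' connDelEvent ends W u w =
      connDelEvent (Function.update ends e s(v, v)) W u w := by
  ext ω
  simp only [Set.mem_preimage, mem_connDelEvent]
  rw [restrict_update_false e _ ω, conn_update_false_iff_loop ends e v]
  -- the two restrictions differ at most at the loop edge `e`
  have hdiag : ((Function.update ends e s(v, v)) e).IsDiag := by simp
  have hagree : ∀ g, g ≠ e → restrict (touches ends (↑W : Set V))ᶜ ω g =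
      restrict (touches (Function.update ends e s(v, v)) (↑W : Set V))ᶜ ω g := by
    intro g hg
    simp only [restrict]
    congr 1
    exact decide_eq_decide.mpr (by rw [Set.mem_compl_iff, Set.mem_compl_iff, mem_touches_loop_iff ends e v hg])
  have key : restrict (touches (Function.update ends e s(v, v)) (↑W : Set V))ᶜ ω =
      Function.update (restrict (touches ends (↑W : Set V))ᶜ ω) e
        (restrict (touches (Function.update ends e s(v, v)) (↑W : Set V))ᶜ ω e) := by
    funext g
    by_cases hg : g = e
    · subst hg; simp
    · rw [Function.update_of_ne hg, hagree g hg]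
  rw [key, conn_update_of_isDiag _ hdiag]

omit [Fintype E] in
/-- The residual disconnection event transports to the loop graph. -/
lemma preimage_delQ (W : Finset V) (a₁ a₂ : V) :
    (fun ω => Function.update ω e false) ⁻¹' delQ ends W a₁ a₂ =
      delQ (Function.update ends e s(v, v)) W a₁ a₂ := by
  simp only [delQ, Set.preimage_compl, preimage_connDelEvent ends e v]

omit [LinearOrder R] [IsStrictOrderedRing R] in
/-- The residual term transports to the loop graph. -/
lemma termW_update_zero_eq_loop (o a₁ a₂ b : V) (W : Finset V) :
    termW (Function.update p e 0) ends o a₁ a₂ b W =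
      termW p (Function.update ends e s(v, v)) o a₁ a₂ b W := by
  simp only [termW, termT, termPD, delConnProb, delShareMass, prob_update_zero_eq_preimage,
    Set.preimage_inter, preimage_connDelEvent ends e v, preimage_delQ ends e v]

omit [LinearOrder R] [IsStrictOrderedRing R] in
/-- **The mean field transports to the loop graph.** -/
lemma Xhat_update_zero_eq_loop (o a₁ a₂ a₃ b : V) :
    Xhat (Function.update p e 0) ends o a₁ a₂ a₃ b =
      Xhat p (Function.update ends e s(v, v)) o a₁ a₂ a₃ b := by
  rw [Xhat_eq_sum, Xhat_eq_sum]
  refine Finset.sum_congr rfl fun W _ => ?_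
  rw [prob_update_zero_eq_preimage, preimage_clusterEvent ends e v, termW_update_zero_eq_loop p ends e v]

omit [LinearOrder R] [IsStrictOrderedRing R] in
/-- **Pinned closed = re-routed to a loop, for the mean-field functional**:
`HMFc (p[e ↦ 0]) ends = HMFc p (ends with e ↦ s(v, v))`. -/
theorem HMFc_update_zero_eq_loop (o a₁ a₂ a₃ b : V) :
    HMFc (Function.update p e 0) ends o a₁ a₂ a₃ b =
      HMFc p (Function.update ends e s(v, v)) o a₁ a₂ a₃ b := by
  have hH : ∀ ω x z, Conn ends (Function.update ω e false) x z ↔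
      Conn (Function.update ends e s(v, v)) ω (id x) (id z) :=
    fun ω x z => conn_update_false_iff_loop ends e v ω x z
  simp only [HMFc, marginC, DEF, Do, EQo, EQ3, EQ3o, massM2, deltaT, gap,
    Xhat_update_zero_eq_loop p ends e v, prob_update_zero_eq_preimage, Set.preimage_inter,
    preimage_PDEvent hH, preimage_TEvent hH, preimage_connEvent hH, preimage_avoidAll_singleton hH,
    id]

end HMFLoop

end Summit.Ventures.PercRepro2
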